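import Summits.QuantumFields.YangMills.Theorems.ColdStartUniversalityLatticeLangevinOscillationCarre
import Summits.QuantumFields.YangMills.Theorems.ColdStartUniversalityLatticeLangevinLiebRobinsonField
import Mathlib.Analysis.SpecialFunctions.Trigonometric.Bounds
import HarnessLib

/-!
# Route `ColdStartUniversality` (fixed-cut-off SZZ dynamics; LIEB–ROBINSON / LOCALITY package, file 5):
# the ONE-LINK oscillation–carré du champ lemma — per-link Lipschitz constants from the carré du champ, chord-normalised

Helper file (seat `ym-line-csu-p1`, g30; `--supports stmt-QuantumFields-24809`).  The bridge between the carré-du-champ language of the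
Bakry–Émery package (g25–g29: `Γ^A`, `wilson_lipschitz_contraction_uniform`) and the link-Lipschitz language of the Lieb–Robinson package (g30):
* `hsForm_su2_sub_one_sq` — `‖U − 1‖_F² = 4(1 − Re tr U/2)` on `SU(2)`;
* ★★ `exists_su2_generator_chord_le` — every `U ∈ SU(2)` is `exp X`, `X ∈ 𝔰𝔲(2)`, with `⟨X,X⟩_HS ≤ 2π²` AND `⟨X,X⟩_HS ≤ (π²/4)‖U − 1‖_F²`
  (arc ≤ (π/2)·chord; Jordan's inequality) — refines g29's `exists_su2_generator_norm_le`;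
* ★★★ `oscillation_oneLink_le_of_carre_le` — for `C¹` `G` with `Γ^A(G) ≤ σ²` on the group and `V, V'` differing only at the link `e₀`:
  `|G(coords V') − G(coords V)| ≤ (π/(2√2))·σ·‖V'_(e₀) − V_(e₀)‖_F`, i.e. `G∘coords` is `(π/(2√2))σ`-Lipschitz in EACH link for the Frobenius
  distance (one-link version of g29's `oscillation_le_of_carre_le`, whose all-links constant `π√#E` is replaced by the chord at one link).
THEOREMS ONLY, no definition, no sorry; all [folklore].  HONEST FRAMING: fixed-lattice geometry; nothing `K`-uniform; no crux, rung or summit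
statement is proved; the Yang–Mills mass gap is NOT proved.
-/

set_option autoImplicit false

noncomputable section

namespace Summit.QuantumFields.YangMills.Theorems.ColdStartUniversality.LiebRobinson

open Matrix Complex Finset
open scoped ComplexConjugate BigOperators Matrix
open Literature.MathematicalPhysics.QuantumFieldTheory
open Literature.MathematicalPhysics.QuantumLattice (fundamentalRep fundamentalLatticeRep continuous_fundamentalRep fundamentalRep_apply)

variable {L : ℕ} [NeZero L]

/-! ## §1. The chord `‖U − 1‖_F` on `SU(2)` and the chord-controlled logarithm -/

/-- `‖U − 1‖_F² = 4(1 − Re tr U / 2)` for `U ∈ SU(2)` (`= 8 sin²(θ/2)` for `U = cos θ·1 + sin θ·J`). [folklore] -/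
theorem hsForm_su2_sub_one_sq (k : Matrix.specialUnitaryGroup (Fin 2) ℂ) :
    frobNorm ((k : Matrix (Fin 2) (Fin 2) ℂ) - 1) ^ 2 = 4 * (1 - (k : Matrix (Fin 2) (Fin 2) ℂ).trace.re / 2) := by
  set U : Matrix (Fin 2) (Fin 2) ℂ := (k : Matrix (Fin 2) (Fin 2) ℂ) with hU
  set τ : ℝ := U.trace.re with hτ
  have hH : Uᴴ = ((τ : ℝ) : ℂ) • (1 : Matrix (Fin 2) (Fin 2) ℂ) - U := su2_conjTranspose_eq k
  have hUU : U * U = ((τ : ℝ) : ℂ) • U - 1 := su2_mul_self_eq k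
  have key : (U - 1) * (U - 1)ᴴ = (((2 : ℝ) - τ : ℝ) : ℂ) • (1 : Matrix (Fin 2) (Fin 2) ℂ) := by
    rw [Matrix.conjTranspose_sub, Matrix.conjTranspose_one, hH]
    have hexp : (U - 1) * (((τ : ℝ) : ℂ) • (1 : Matrix (Fin 2) (Fin 2) ℂ) - U - 1) =
        ((τ : ℝ) : ℂ) • U - U * U - U - ((τ : ℝ) : ℂ) • (1 : Matrix (Fin 2) (Fin 2) ℂ) + U + 1 := by
      simp only [mul_sub, sub_mul, one_mul, mul_one, Matrix.mul_smul]
      abel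
    rw [hexp, hUU]
    push_cast
    module
  rw [← hsForm_self_eq_frobNorm_sq, hsForm_apply, key, Matrix.trace_smul, Matrix.trace_one, Fintype.card_fin, smul_eq_mul]
  push_cast
  simp only [Complex.mul_re, Complex.sub_re, Complex.ofReal_re, Complex.ofReal_im, Complex.sub_im, Complex.re_ofNat,
    Complex.im_ofNat]
  rw [hτ]; ring


/-- ★★ **CHORD-CONTROLLED logarithm on `SU(2)`**: every `U ∈ SU(2)` is `exp X` with `X ∈ 𝔰𝔲(2)`, `⟨X, X⟩_HS ≤ 2π²` AND
`⟨X, X⟩_HS ≤ (π²/4)·‖U − 1‖_F²` (arc ≤ (π/2)·chord on the 3-sphere: `U = cos θ·1 + sin θ·J`, `⟨X,X⟩ = 2θ²`, `‖U − 1‖_F² = 8 sin²(θ/2)`, Jordan's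
inequality `θ ≤ π sin(θ/2)` on `[0, π]`).  Refines `exists_su2_generator_norm_le`. [folklore] -/
theorem exists_su2_generator_chord_le (k : Matrix.specialUnitaryGroup (Fin 2) ℂ) :
    ∃ X : Matrix (Fin 2) (Fin 2) ℂ, Xᴴ = -X ∧ X.trace = 0 ∧ NormedSpace.exp X = (k : Matrix (Fin 2) (Fin 2) ℂ) ∧
      hsForm 2 X X ≤ 2 * Real.pi ^ 2 ∧ hsForm 2 X X ≤ Real.pi ^ 2 / 4 * frobNorm ((k : Matrix (Fin 2) (Fin 2) ℂ) - 1) ^ 2 := by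
  set U : Matrix (Fin 2) (Fin 2) ℂ := (k : Matrix (Fin 2) (Fin 2) ℂ) with hU
  set c : ℝ := U.trace.re / 2 with hc
  have hc1 : |c| ≤ 1 := abs_re_trace_div_two_le k
  have hcl : -1 ≤ c := (abs_le.1 hc1).1
  have hcu : c ≤ 1 := (abs_le.1 hc1).2
  set A : Matrix (Fin 2) (Fin 2) ℂ := U - ((c : ℝ) : ℂ) • (1 : Matrix (Fin 2) (Fin 2) ℂ) with hA
  have hAA : A * A = (((c : ℂ)) ^ 2 - 1) • (1 : Matrix (Fin 2) (Fin 2) ℂ) := su2_sub_smul_one_mul_self k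
  have hAskew : Aᴴ = -A := su2_sub_smul_one_skew k
  have hAtr : A.trace = 0 := su2_sub_smul_one_trace k
  have hAhs : hsForm 2 A A = 2 * (1 - c ^ 2) := by
    rw [hsForm_apply, hAskew, mul_neg, hAA, Matrix.trace_neg, Matrix.trace_smul, Matrix.trace_one, Fintype.card_fin, smul_eq_mul]
    have e : (((c : ℂ)) ^ 2 - 1) = (((c ^ 2 - 1 : ℝ)) : ℂ) := by push_cast; ring
    rw [e, Complex.neg_re, show ((2 : ℕ) : ℂ) = ((2 : ℝ) : ℂ) by norm_num, ← Complex.ofReal_mul, Complex.ofReal_re]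
    ring
  set θ : ℝ := Real.arccos c with hθ
  have hcos : Real.cos θ = c := Real.cos_arccos hcl hcu
  have hθ0 : 0 ≤ θ := Real.arccos_nonneg c
  have hθπ : θ ≤ Real.pi := Real.arccos_le_pi c
  have hsin0 : 0 ≤ Real.sin θ := Real.sin_nonneg_of_nonneg_of_le_pi hθ0 hθπ
  have hsin2 : Real.sin θ ^ 2 = 1 - c ^ 2 := by rw [Real.sin_sq, hcos]
  have hθ2 : θ ^ 2 ≤ Real.pi ^ 2 := by nlinarith [Real.pi_pos]
  -- the chord: `‖U − 1‖_F² = 4(1 − c)` and Jordan's inequality `2θ² ≤ π²(1 − cos θ)`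
  have hchord : frobNorm (U - 1) ^ 2 = 4 * (1 - c) := hsForm_su2_sub_one_sq k
  have hjordan : 2 * θ ^ 2 ≤ Real.pi ^ 2 * (1 - c) := by
    have hj := Real.mul_le_sin (x := θ / 2) (by linarith) (by linarith)
    have hsq : Real.sin (θ / 2) ^ 2 = (1 - c) / 2 := by
      rw [Real.sin_sq_eq_half_sub, show 2 * (θ / 2) = θ by ring, hcos]; ring
    have hj0 : 0 ≤ 2 / Real.pi * (θ / 2) := by positivity
    have hj2 : (2 / Real.pi * (θ / 2)) ^ 2 ≤ Real.sin (θ / 2) ^ 2 := pow_le_pow_left₀ hj0 hj 2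
    rw [hsq] at hj2
    have hπ := Real.pi_pos
    have e1 : (2 / Real.pi * (θ / 2)) ^ 2 = θ ^ 2 / Real.pi ^ 2 := by field_simp
    rw [e1, div_le_iff₀ (by positivity)] at hj2
    nlinarith [hj2]
  by_cases hs : Real.sin θ = 0
  · -- `c = ±1`, `A = 0`, `U = c·1`
    have hc2 : c * c = 1 := by nlinarith [hsin2, hs]
    have hA0 : A = 0 := by
      have h : hsForm 2 A A = 0 := by rw [hAhs]; nlinarith [hc2]
      exact hsForm_self_eq_zero.1 h
    have hUc : U = ((c : ℝ) : ℂ) • (1 : Matrix (Fin 2) (Fin 2) ℂ) := by rw [← sub_eq_zero]; exact hA0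
    rcases mul_self_eq_one_iff.mp hc2 with h1 | h1
    · -- `U = 1`: `X = 0`
      refine ⟨0, by simp, by simp, ?_, ?_, ?_⟩
      · rw [NormedSpace.exp_zero, hUc, h1]; simp
      · rw [hsForm_apply]; simp only [Matrix.conjTranspose_zero, mul_zero, Matrix.trace_zero, Complex.zero_re]; positivity
      · rw [hsForm_apply]; simp only [Matrix.conjTranspose_zero, mul_zero, Matrix.trace_zero, Complex.zero_re]; positivity
    · -- `U = −1`: `X = π·J₀`, `J₀ = diag(i, −i)`
      set J₀ : Matrix (Fin 2) (Fin 2) ℂ := !![Complex.I, 0; 0, -Complex.I] with hJ₀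
      have hJ₀sq : J₀ * J₀ = -1 := by
        rw [hJ₀]; ext i j; fin_cases i <;> fin_cases j <;> simp [Matrix.mul_apply, Fin.sum_univ_two]
      have hJ₀skew : J₀ᴴ = -J₀ := by
        rw [hJ₀]; ext i j; fin_cases i <;> fin_cases j <;> simp [Matrix.conjTranspose_apply]
      have hJ₀tr : J₀.trace = 0 := by rw [hJ₀]; simp [Matrix.trace_fin_two]
      have hJJ : hsForm 2 J₀ J₀ = 2 := by
        rw [hsForm_apply, hJ₀skew, mul_neg, hJ₀sq, neg_neg, Matrix.trace_one, Fintype.card_fin]; norm_num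
      refine ⟨((Real.pi : ℝ) : ℂ) • J₀, ?_, ?_, ?_, ?_, ?_⟩
      · rw [Matrix.conjTranspose_smul, hJ₀skew, smul_neg]
        have hstar : star ((Real.pi : ℝ) : ℂ) = ((Real.pi : ℝ) : ℂ) := Complex.conj_ofReal _
        rw [hstar]
      · rw [Matrix.trace_smul, hJ₀tr, smul_zero]
      · rw [exp_smul_of_mul_self_eq_neg_one hJ₀sq, Real.cos_pi, Real.sin_pi, hUc, h1]; simp
      · rw [hsForm_ofReal_smul_self, hJJ]; nlinarith [Real.pi_pos]
      · rw [hsForm_ofReal_smul_self, hJJ, hchord, h1]; nlinarith [Real.pi_pos]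
  · -- generic case: `J = A / sin θ`, `X = θ·J`
    have hsinpos : 0 < Real.sin θ := lt_of_le_of_ne hsin0 (Ne.symm hs)
    set J : Matrix (Fin 2) (Fin 2) ℂ := (((Real.sin θ)⁻¹ : ℝ) : ℂ) • A with hJ
    have hcoef : ((((Real.sin θ)⁻¹ : ℝ) : ℂ) * (((Real.sin θ)⁻¹ : ℝ) : ℂ)) * ((c : ℂ) ^ 2 - 1) = -1 := by
      have h1 : ((c : ℂ) ^ 2 - 1) = -((((Real.sin θ) * (Real.sin θ) : ℝ)) : ℂ) := by
        rw [← sq, hsin2]; push_cast; ring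
      rw [h1, ← Complex.ofReal_mul, mul_neg, ← Complex.ofReal_mul]
      have h2 : (Real.sin θ)⁻¹ * (Real.sin θ)⁻¹ * (Real.sin θ * Real.sin θ) = 1 := by field_simp
      rw [h2]; simp
    have hJsq : J * J = -1 := by
      rw [hJ, smul_mul_assoc, mul_smul_comm, hAA, smul_smul, smul_smul, hcoef, neg_one_smul]
    have hXX : hsForm 2 (((θ : ℝ) : ℂ) • J) (((θ : ℝ) : ℂ) • J) = 2 * θ ^ 2 := by
      rw [hsForm_ofReal_smul_self, hJ, hsForm_ofReal_smul_self, hAhs, ← hsin2]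
      have e : θ * θ * ((Real.sin θ)⁻¹ * (Real.sin θ)⁻¹ * (2 * Real.sin θ ^ 2)) = 2 * θ ^ 2 := by field_simp
      rw [e]
    refine ⟨((θ : ℝ) : ℂ) • J, ?_, ?_, ?_, ?_, ?_⟩
    · rw [Matrix.conjTranspose_smul, hJ, Matrix.conjTranspose_smul, hAskew, smul_neg, smul_neg]
      have hs1 : star ((θ : ℝ) : ℂ) = ((θ : ℝ) : ℂ) := Complex.conj_ofReal _
      have hs2 : star (((Real.sin θ)⁻¹ : ℝ) : ℂ) = (((Real.sin θ)⁻¹ : ℝ) : ℂ) := Complex.conj_ofReal _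
      rw [hs1, hs2]
    · rw [Matrix.trace_smul, hJ, Matrix.trace_smul, hAtr, smul_zero, smul_zero]
    · rw [exp_smul_of_mul_self_eq_neg_one hJsq θ, hcos, hJ, hA, smul_smul]
      have hss : ((Real.sin θ : ℝ) : ℂ) * (((Real.sin θ)⁻¹ : ℝ) : ℂ) = 1 := by
        rw [← Complex.ofReal_mul, mul_inv_cancel₀ hs]; simp
      rw [hss, one_smul]
      abel
    · rw [hXX]; linarith
    · rw [hXX, hchord]; nlinarith [hjordan]


/-! ## §2. The one-link oscillation lemma -/

section Osc

open scoped Matrix.Norms.Operator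

/-- ★★★ **ONE-LINK oscillation–carré du champ lemma on `SU(2)^E` (per-link Lipschitz constants from the carré du champ)**: for a `C¹`
function `G` of the real link coordinates with `Γ^A(G) ≤ σ²` on the group and two configurations `V, V'` which differ ONLY at the link `e₀`:
`|G(coords V') − G(coords V)| ≤ (π/(2√2))·σ·‖V'_(e₀) − V_(e₀)‖_F` — i.e. `G∘coords` is `(π/(2√2))σ`-Lipschitz in EACH link for the Frobenius
(chordal) distance.  Move only the link `e₀` along `s ↦ e^(sX)·V_(e₀)` with the CHORD-controlled logarithm `X` of `V'_(e₀)V_(e₀)⁻¹`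
(`exists_su2_generator_chord_le`: `⟨X,X⟩ ≤ (π²/4)‖V'_(e₀)V_(e₀)⁻¹ − 1‖_F²`), so that the velocity coefficients satisfy `Σ_n c_n² = ½⟨X,X⟩ ≤ (π²/8)‖V'_(e₀) −
V_(e₀)‖_F²`; Cauchy–Schwarz against `Σ_n (W_nG)² = Γ^A(G)` and the mean value inequality.  [folklore] -/
theorem oscillation_oneLink_le_of_carre_le (L : ℕ) [NeZero L] (β' : ℝ) {G : (Edge 3 L × Fin 2 × Fin 2 × Bool → ℝ) → ℝ} (hG : ContDiff ℝ 1 G) {σ : ℝ} (hσ : 0 ≤ σ)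
    (e₀ : Edge 3 L) :
    let coords : GaugeConfig 3 L (Matrix.specialUnitaryGroup (Fin 2) ℂ) → (Edge 3 L × Fin 2 × Fin 2 × Bool → ℝ) :=
      fun V q => (fun z : ℂ => if q.2.2.2 then z.im else z.re)
        ((fundamentalRep (Fin 2) (V q.1) : Matrix (Fin 2) (Fin 2) ℂ) q.2.1 q.2.2.1)
    let A : GaugeConfig 3 L (Matrix.specialUnitaryGroup (Fin 2) ℂ) → (Edge 3 L × Fin 2 × Fin 2 × Bool) →
        (Edge 3 L × Fin 2 × Fin 2 × Bool) → ℝ := fun V i j =>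
      ∑ n : Edge 3 L × NoiseIdx 2,
        (if n.1 = i.1 then (fun z : ℂ => if i.2.2.2 then z.im else z.re)
          ((latticeLangevinDynamics (fundamentalLatticeRep 2) β').noise
            (matrixConfig (fundamentalRep (Fin 2)) V) i.1 n.2 i.2.1 i.2.2.1) else 0) *
        (if n.1 = j.1 then (fun z : ℂ => if j.2.2.2 then z.im else z.re)
          ((latticeLangevinDynamics (fundamentalLatticeRep 2) β').noise
            (matrixConfig (fundamentalRep (Fin 2)) V) j.1 n.2 j.2.1 j.2.2.1) else 0)
    (∀ x, (∑ i : Edge 3 L × Fin 2 × Fin 2 × Bool, ∑ j : Edge 3 L × Fin 2 × Fin 2 × Bool, fderiv ℝ G (coords x) (Pi.single i 1) * fderiv ℝ G (coords x) (Pi.single j 1) * A x i j) ≤ σ ^ 2) → ∀ V V' : (GaugeConfig 3 L (Matrix.specialUnitaryGroup (Fin 2) ℂ)),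
      (∀ e, e ≠ e₀ → V' e = V e) →
      |G (coords V') - G (coords V)| ≤ Real.pi / (2 * Real.sqrt 2) * σ *
        frobNorm ((V' e₀ : Matrix (Fin 2) (Fin 2) ℂ) - (V e₀ : Matrix (Fin 2) (Fin 2) ℂ)) := by
  intro coords A hΓ V V' hVV'
  classical
  have hGd : Differentiable ℝ G := hG.differentiable (by norm_num)
  -- the Frobenius distance of the two links and of the relative rotation
  set Fd : ℝ := frobNorm ((V' e₀ : Matrix (Fin 2) (Fin 2) ℂ) - (V e₀ : Matrix (Fin 2) (Fin 2) ℂ)) with hFd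
  have hFd0 : 0 ≤ Fd := frobNorm_nonneg _
  have hFdk : frobNorm (((V' e₀ * (V e₀)⁻¹ : Matrix.specialUnitaryGroup (Fin 2) ℂ) : Matrix (Fin 2) (Fin 2) ℂ) - 1) = Fd := by
    have hu : ((V e₀ : Matrix.specialUnitaryGroup (Fin 2) ℂ) : Matrix (Fin 2) (Fin 2) ℂ) ∈ Matrix.unitaryGroup (Fin 2) ℂ :=
      Matrix.specialUnitaryGroup_le_unitaryGroup (V e₀).2
    have hmul : (((V' e₀ * (V e₀)⁻¹ : Matrix.specialUnitaryGroup (Fin 2) ℂ) : Matrix (Fin 2) (Fin 2) ℂ) - 1) * (V e₀ : Matrix (Fin 2) (Fin 2) ℂ) =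
        (V' e₀ : Matrix (Fin 2) (Fin 2) ℂ) - (V e₀ : Matrix (Fin 2) (Fin 2) ℂ) := by
      rw [Matrix.sub_mul, Matrix.one_mul, Submonoid.coe_mul, Matrix.mul_assoc]
      have hinv : ((V e₀)⁻¹ : Matrix.specialUnitaryGroup (Fin 2) ℂ) * V e₀ = 1 := inv_mul_cancel _
      have hinv' : (((V e₀)⁻¹ : Matrix.specialUnitaryGroup (Fin 2) ℂ) : Matrix (Fin 2) (Fin 2) ℂ) * (V e₀ : Matrix (Fin 2) (Fin 2) ℂ) = 1 := by
        rw [← Submonoid.coe_mul, hinv]; rfl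
      rw [hinv', Matrix.mul_one]
    rw [hFd, ← hmul, frobNorm_mul_unitary _ hu]
  -- chord-controlled logarithm of `V'_(e₀) V_(e₀)⁻¹`, zero at the other links
  obtain ⟨X₀, hX₀skew, hX₀tr, hX₀exp, -, hX₀chord⟩ := exists_su2_generator_chord_le (V' e₀ * (V e₀)⁻¹)
  set X : Edge 3 L → Matrix (Fin (fundamentalLatticeRep 2).N) (Fin (fundamentalLatticeRep 2).N) ℂ := fun e => if e = e₀ then X₀ else 0 with hXdef
  have hXskew : ∀ e, (X e)ᴴ = -(X e) := fun e => by
    by_cases he : e = e₀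
    · simp only [hXdef, he, if_true]; exact hX₀skew
    · simp only [hXdef, he, if_false, Matrix.conjTranspose_zero, neg_zero]
  have hXtr : ∀ e, (X e).trace = 0 := fun e => by
    by_cases he : e = e₀
    · simp only [hXdef, he, if_true]; exact hX₀tr
    · simp only [hXdef, he, if_false, Matrix.trace_zero]
  have hXexp : ∀ e, NormedSpace.exp (X e) = ((V' e * (V e)⁻¹ : Matrix.specialUnitaryGroup (Fin 2) ℂ) : Matrix (Fin 2) (Fin 2) ℂ) := fun e => by
    by_cases he : e = e₀
    · simp only [hXdef, he, if_true]; exact hX₀exp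
    · simp only [hXdef, he, if_false, NormedSpace.exp_zero, hVV' e he, mul_inv_cancel]; rfl
  have hXnorm : ∑ e : Edge 3 L, hsForm (fundamentalLatticeRep 2).N (X e) (X e) ≤ Real.pi ^ 2 / 4 * Fd ^ 2 := by
    rw [Finset.sum_eq_single e₀]
    · simp only [hXdef, if_true]
      have h := hX₀chord
      rw [hFdk] at h
      exact h
    · intro e _ he; simp only [hXdef, he, if_false]; rw [hsForm_apply, zero_mul, Matrix.trace_zero, Complex.zero_re]
    · intro h; exact absurd (Finset.mem_univ _) h
  set u : ℝ → (GaugeConfig 3 L (Matrix.specialUnitaryGroup (Fin 2) ℂ)) := fun s => (fun e => SUNBakryEmery.expSU (N := 2) (Y := Matrix.of fun i j : Fin 2 => X e i j) (hXskew e) (hXtr e) s) with hu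
  have hu0 : u 0 * V = V := by
    funext e
    have h1 : (SUNBakryEmery.expSU (N := 2) (Y := Matrix.of fun i j : Fin 2 => X e i j) (hXskew e) (hXtr e) (0 : ℝ)) = 1 :=
      Subtype.ext (by rw [SUNBakryEmery.coe_expSU, zero_smul, NormedSpace.exp_zero]; rfl)
    simp only [hu, Pi.mul_apply, h1, one_mul]
  have hu1 : u 1 * V = V' := by
    funext e
    have h1 : (SUNBakryEmery.expSU (N := 2) (Y := Matrix.of fun i j : Fin 2 => X e i j) (hXskew e) (hXtr e) (1 : ℝ)) = V' e * (V e)⁻¹ := by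
      apply Subtype.ext
      rw [SUNBakryEmery.coe_expSU, one_smul]
      exact hXexp e
    simp only [hu, Pi.mul_apply, h1, inv_mul_cancel_right]
  -- the coefficients `c_(e,ν) = ⟨X_e, 𝐩E_ν⟩/√2`, `Σ_n c_n² = ½ Σ_e ⟨X_e,X_e⟩ ≤ π²·#E`
  set c : Edge 3 L × NoiseIdx (fundamentalLatticeRep 2).N → ℝ := fun n =>
    hsForm (fundamentalLatticeRep 2).N (X n.1) ((fundamentalLatticeRep 2).lieProj (noiseDir n.2)) / Real.sqrt 2 with hc
  have hXmem : ∀ e, X e ∈ (fundamentalLatticeRep 2).lieAlg := fun e =>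
    mem_lieAlg_two_of_star_eq_neg (by rw [Matrix.star_eq_conjTranspose]; exact hXskew e) (hXtr e)
  have hcsq : ∑ n : Edge 3 L × NoiseIdx (fundamentalLatticeRep 2).N, c n ^ 2 ≤ Real.pi ^ 2 / 8 * Fd ^ 2 := by
    have h1 : ∀ e : Edge 3 L, ∑ ν : NoiseIdx (fundamentalLatticeRep 2).N, c (e, ν) ^ 2 =
        hsForm (fundamentalLatticeRep 2).N (X e) (X e) / 2 := by
      intro e
      have hP := sum_hsForm_lieProj_noiseDir_sq (r := fundamentalLatticeRep 2) (X e)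
      rw [(fundamentalLatticeRep 2).lieProj_of_mem (hXmem e)] at hP
      rw [← hP, Finset.sum_div]
      refine Finset.sum_congr rfl fun ν _ => ?_
      simp only [hc, div_pow, Real.sq_sqrt (show (0:ℝ) ≤ 2 by norm_num)]
    have h2 : ∑ n : Edge 3 L × NoiseIdx (fundamentalLatticeRep 2).N, c n ^ 2 =
        ∑ e : Edge 3 L, ∑ ν : NoiseIdx (fundamentalLatticeRep 2).N, c (e, ν) ^ 2 := by
      rw [Fintype.sum_prod_type]
    rw [h2]
    calc ∑ e : Edge 3 L, ∑ ν : NoiseIdx (fundamentalLatticeRep 2).N, c (e, ν) ^ 2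
        = ∑ e : Edge 3 L, hsForm (fundamentalLatticeRep 2).N (X e) (X e) / 2 := Finset.sum_congr rfl fun e _ => h1 e
      _ = (∑ e : Edge 3 L, hsForm (fundamentalLatticeRep 2).N (X e) (X e)) / 2 := by rw [Finset.sum_div]
      _ ≤ (Real.pi ^ 2 / 4 * Fd ^ 2) / 2 := by gcongr
      _ = Real.pi ^ 2 / 8 * Fd ^ 2 := by ring
  -- the path `φ(s) = G(coords(u s · V))` and its derivative `Σ_n c_n W_nG(V_s)`
  set φ : ℝ → ℝ := fun s => G (coords (u s * V)) with hφ
  have hder : ∀ s, HasDerivAt φ (∑ n : Edge 3 L × NoiseIdx (fundamentalLatticeRep 2).N,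
      c n * fderiv ℝ G ((fun (V : GaugeConfig 3 L (Matrix.specialUnitaryGroup (Fin 2) ℂ)) (q : Edge 3 L × Fin (fundamentalLatticeRep 2).N × Fin (fundamentalLatticeRep 2).N × Bool) => (fun z : ℂ => if q.2.2.2 then z.im else z.re) ((fundamentalRep (Fin 2) (V q.1) : Matrix (Fin 2) (Fin 2) ℂ) q.2.1 q.2.2.1)) ((fun e => SUNBakryEmery.expSU (N := 2) (Y := Matrix.of fun i j : Fin 2 => X e i j) (hXskew e) (hXtr e) s) * V)) (fun q : Edge 3 L × Fin (fundamentalLatticeRep 2).N × Fin (fundamentalLatticeRep 2).N × Bool => if n.1 = q.1 then (fun z : ℂ => if q.2.2.2 then z.im else z.re) (((Real.sqrt 2 : ℂ) • ((fundamentalLatticeRep 2).lieProj (noiseDir n.2) * (fun (ee : Edge 3 L) => Matrix.of fun (i j : Fin (fundamentalLatticeRep 2).N) => (((fun (V : GaugeConfig 3 L (Matrix.specialUnitaryGroup (Fin 2) ℂ)) (q : Edge 3 L × Fin (fundamentalLatticeRep 2).N × Fin (fundamentalLatticeRep 2).N × Bool) => (fun z : ℂ => if q.2.2.2 then z.im else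 z.re) ((fundamentalRep (Fin 2) (V q.1) : Matrix (Fin 2) (Fin 2) ℂ) q.2.1 q.2.2.1)) ((fun e => SUNBakryEmery.expSU (N := 2) (Y := Matrix.of fun i j : Fin 2 => X e i j) (hXskew e) (hXtr e) s) * V) (ee, i, j, false) : ℝ) : ℂ) + (((fun (V : GaugeConfig 3 L (Matrix.specialUnitaryGroup (Fin 2) ℂ)) (q : Edge 3 L × Fin (fundamentalLatticeRep 2).N × Fin (fundamentalLatticeRep 2).N × Bool) => (fun z : ℂ => if q.2.2.2 then z.im else z.re) ((fundamentalRep (Fin 2) (V q.1) : Matrix (Fin 2) (Fin 2) ℂ) q.2.1 q.2.2.1)) ((fun e => SUNBakryEmery.expSU (N := 2) (Y := Matrix.of fun i j : Fin 2 => X e i j) (hXskew e) (hXtr e) s) * V) (ee, i, j, true) : ℝ) : ℂ) * Complex.I) q.1)) q.2.1 q.2.2.1) else 0)) s := by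
    intro s
    have h := hasDerivAt_comp_coords_multiFlow (L := L) X hXskew hXtr V hGd s
    have hfield : (fun q : Edge 3 L × Fin (fundamentalLatticeRep 2).N × Fin (fundamentalLatticeRep 2).N × Bool => (fun z : ℂ => if q.2.2.2 then z.im else z.re) ((X q.1 * (fun (ee : Edge 3 L) => Matrix.of fun (i j : Fin (fundamentalLatticeRep 2).N) => (((fun (V : GaugeConfig 3 L (Matrix.specialUnitaryGroup (Fin 2) ℂ)) (q : Edge 3 L × Fin (fundamentalLatticeRep 2).N × Fin (fundamentalLatticeRep 2).N × Bool) => (fun z : ℂ => if q.2.2.2 then z.im else z.re) ((fundamentalRep (Fin 2) (V q.1) : Matrix (Fin 2) (Fin 2) ℂ) q.2.1 q.2.2.1)) ((fun e => SUNBakryEmery.expSU (N := 2) (Y := Matrix.of fun i j : Fin 2 => X e i j) (hXskew e) (hXtr e) s) * V) (ee, i, j, false) : ℝ) : ℂ) + (((fun (V : GaugeConfig 3 L (Matrix.specialUnitaryGroup (Fin 2) ℂ)) (q : Edge 3 L × Fin (fundamentalLatticeRep 2).N × Fin (fundamentalLatticeRep 2).N × Bool) => (fun z : ℂ => if q.2.2.2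 then z.im else z.re) ((fundamentalRep (Fin 2) (V q.1) : Matrix (Fin 2) (Fin 2) ℂ) q.2.1 q.2.2.1)) ((fun e => SUNBakryEmery.expSU (N := 2) (Y := Matrix.of fun i j : Fin 2 => X e i j) (hXskew e) (hXtr e) s) * V) (ee, i, j, true) : ℝ) : ℂ) * Complex.I) q.1) q.2.1 q.2.2.1)) =
        ∑ n : Edge 3 L × NoiseIdx (fundamentalLatticeRep 2).N, c n • (fun q : Edge 3 L × Fin (fundamentalLatticeRep 2).N × Fin (fundamentalLatticeRep 2).N × Bool => if n.1 = q.1 then (fun z : ℂ => if q.2.2.2 then z.im else z.re) (((Real.sqrt 2 : ℂ) • ((fundamentalLatticeRep 2).lieProj (noiseDir n.2) * (fun (ee : Edge 3 L) => Matrix.of fun (i j : Fin (fundamentalLatticeRep 2).N) => (((fun (V : GaugeConfig 3 L (Matrix.specialUnitaryGroup (Fin 2) ℂ)) (q : Edge 3 L × Fin (fundamentalLatticeRep 2).N × Fin (fundamentalLatticeRep 2).N × Bool) => (fun z : ℂ => if q.2.2.2 then z.im else z.re) ((fundamentalRep (Fin 2) (V q.1) : Matrix (Fin 2) (Fin 2)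 ℂ) q.2.1 q.2.2.1)) ((fun e => SUNBakryEmery.expSU (N := 2) (Y := Matrix.of fun i j : Fin 2 => X e i j) (hXskew e) (hXtr e) s) * V) (ee, i, j, false) : ℝ) : ℂ) + (((fun (V : GaugeConfig 3 L (Matrix.specialUnitaryGroup (Fin 2) ℂ)) (q : Edge 3 L × Fin (fundamentalLatticeRep 2).N × Fin (fundamentalLatticeRep 2).N × Bool) => (fun z : ℂ => if q.2.2.2 then z.im else z.re) ((fundamentalRep (Fin 2) (V q.1) : Matrix (Fin 2) (Fin 2) ℂ) q.2.1 q.2.2.1)) ((fun e => SUNBakryEmery.expSU (N := 2) (Y := Matrix.of fun i j : Fin 2 => X e i j) (hXskew e) (hXtr e) s) * V) (ee, i, j, true) : ℝ) : ℂ) * Complex.I) q.1)) q.2.1 q.2.2.1) else 0) :=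
      multiField_eq_sum_smul_frame (L := L) X hXmem ((fun (V : GaugeConfig 3 L (Matrix.specialUnitaryGroup (Fin 2) ℂ)) (q : Edge 3 L × Fin (fundamentalLatticeRep 2).N × Fin (fundamentalLatticeRep 2).N × Bool) => (fun z : ℂ => if q.2.2.2 then z.im else z.re) ((fundamentalRep (Fin 2) (V q.1) : Matrix (Fin 2) (Fin 2) ℂ) q.2.1 q.2.2.1)) ((fun e => SUNBakryEmery.expSU (N := 2) (Y := Matrix.of fun i j : Fin 2 => X e i j) (hXskew e) (hXtr e) s) * V))
    rw [hfield, map_sum] at h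
    refine h.congr_deriv (Finset.sum_congr rfl fun n _ => ?_)
    rw [map_smul, smul_eq_mul]
    rfl
  -- bound on the derivative: Cauchy–Schwarz and the carré du champ dictionary `Σ_n (W_nG)² = Γ^A(G)`
  have hbound : ∀ s, |∑ n : Edge 3 L × NoiseIdx (fundamentalLatticeRep 2).N,
      c n * fderiv ℝ G (coords (u s * V)) (fun q : Edge 3 L × Fin (fundamentalLatticeRep 2).N × Fin (fundamentalLatticeRep 2).N × Bool => if n.1 = q.1 then (fun z : ℂ => if q.2.2.2 then z.im else z.re) (((Real.sqrt 2 : ℂ) • ((fundamentalLatticeRep 2).lieProj (noiseDir n.2) * (fun (ee : Edge 3 L) => Matrix.of fun (i j : Fin (fundamentalLatticeRep 2).N) => (((coords (u s * V)) (ee, i, j, false) : ℝ) : ℂ) + (((coords (u s * V)) (ee, i, j, true) : ℝ) : ℂ) * Complex.I) q.1)) q.2.1 q.2.2.1) else 0)| ≤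
      Real.pi / (2 * Real.sqrt 2) * σ * Fd := by
    intro s
    set w : Edge 3 L × NoiseIdx (fundamentalLatticeRep 2).N → ℝ := fun n =>
      fderiv ℝ G (coords (u s * V)) (fun q : Edge 3 L × Fin (fundamentalLatticeRep 2).N × Fin (fundamentalLatticeRep 2).N × Bool => if n.1 = q.1 then (fun z : ℂ => if q.2.2.2 then z.im else z.re) (((Real.sqrt 2 : ℂ) • ((fundamentalLatticeRep 2).lieProj (noiseDir n.2) * (fun (ee : Edge 3 L) => Matrix.of fun (i j : Fin (fundamentalLatticeRep 2).N) => (((coords (u s * V)) (ee, i, j, false) : ℝ) : ℂ) + (((coords (u s * V)) (ee, i, j, true) : ℝ) : ℂ) * Complex.I) q.1)) q.2.1 q.2.2.1) else 0) with hw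
    have hCS := Finset.sum_mul_sq_le_sq_mul_sq Finset.univ c w
    have hframe : (∑ i : Edge 3 L × Fin 2 × Fin 2 × Bool, ∑ j : Edge 3 L × Fin 2 × Fin 2 × Bool, fderiv ℝ G (coords (u s * V)) (Pi.single i 1) * fderiv ℝ G (coords (u s * V)) (Pi.single j 1) * A (u s * V) i j) = ∑ n : Edge 3 L × NoiseIdx (fundamentalLatticeRep 2).N,
        fderiv ℝ G (coords (u s * V)) (fun q : Edge 3 L × Fin (fundamentalLatticeRep 2).N × Fin (fundamentalLatticeRep 2).N × Bool => if n.1 = q.1 then (fun z : ℂ => if q.2.2.2 then z.im else z.re) (((Real.sqrt 2 : ℂ) • ((fundamentalLatticeRep 2).lieProj (noiseDir n.2) * (fun (ee : Edge 3 L) => Matrix.of fun (i j : Fin (fundamentalLatticeRep 2).N) => (((coords (u s * V)) (ee, i, j, false) : ℝ) : ℂ) + (((coords (u s * V)) (ee, i, j, true) : ℝ) : ℂ) * Complex.I) q.1)) q.2.1 q.2.2.1) else 0) * fderiv ℝ G (coords (u s * V)) (fun q : Edge 3 L × Fin (fundamentalLatticeRep 2).N × Fin (fundamentalLatticeRep 2).N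 × Bool => if n.1 = q.1 then (fun z : ℂ => if q.2.2.2 then z.im else z.re) (((Real.sqrt 2 : ℂ) • ((fundamentalLatticeRep 2).lieProj (noiseDir n.2) * (fun (ee : Edge 3 L) => Matrix.of fun (i j : Fin (fundamentalLatticeRep 2).N) => (((coords (u s * V)) (ee, i, j, false) : ℝ) : ℂ) + (((coords (u s * V)) (ee, i, j, true) : ℝ) : ℂ) * Complex.I) q.1)) q.2.1 q.2.2.1) else 0) :=
      carre_eq_sum_frameDeriv_mul L β' G G (u s * V)
    have hw_le : ∑ n : Edge 3 L × NoiseIdx (fundamentalLatticeRep 2).N, w n ^ 2 ≤ σ ^ 2 := by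
      have h := hΓ (u s * V)
      rw [hframe] at h
      simpa only [hw, sq] using h
    have h1 : (∑ n : Edge 3 L × NoiseIdx (fundamentalLatticeRep 2).N, c n * w n) ^ 2 ≤
        (Real.pi ^ 2 / 8 * Fd ^ 2) * σ ^ 2 :=
      hCS.trans (mul_le_mul hcsq hw_le (Finset.sum_nonneg fun n _ => sq_nonneg _) (by positivity))
    have h2 := Real.abs_le_sqrt h1
    have h3 : Real.sqrt ((Real.pi ^ 2 / 8 * Fd ^ 2) * σ ^ 2) = Real.pi / (2 * Real.sqrt 2) * σ * Fd := by
      have h8 : Real.sqrt 8 = 2 * Real.sqrt 2 := by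
        rw [show (8 : ℝ) = 2 ^ 2 * 2 by norm_num, Real.sqrt_mul (by positivity), Real.sqrt_sq (by norm_num : (0:ℝ) ≤ 2)]
      rw [Real.sqrt_mul (by positivity), Real.sqrt_mul (by positivity), Real.sqrt_div (by positivity), Real.sqrt_sq Real.pi_pos.le,
        Real.sqrt_sq hσ, Real.sqrt_sq hFd0, h8]
      ring
    rw [h3] at h2
    exact h2
  -- mean value inequality on `[0, 1]`
  have hMV := norm_image_sub_le_of_norm_deriv_le_segment' (f := φ) (a := (0 : ℝ)) (b := 1)
    (C := Real.pi / (2 * Real.sqrt 2) * σ * Fd)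
    (fun s _ => (hder s).hasDerivWithinAt) (fun s _ => by rw [Real.norm_eq_abs]; exact hbound s) 1
    (Set.right_mem_Icc.2 zero_le_one)
  rw [Real.norm_eq_abs, sub_zero, mul_one] at hMV
  have hφ0 : φ 0 = G (coords V) := by simp only [hφ, hu0]
  have hφ1 : φ 1 = G (coords V') := by simp only [hφ, hu1]
  rw [hφ0, hφ1] at hMV
  exact hMV


end Osc

end Summit.QuantumFields.YangMills.Theorems.ColdStartUniversality.LiebRobinson
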